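import Summits.CriticalPhenomena.PercolationContinuityZ3.Theorems.PercNearOneGluingNoHeavyLowerTailKNGoodGMgcTargetAlgebra
import HarnessLib

/-!
# Target expansion: THEOREM B's goodness functional of the contracted observer equals `Σ_v phiCoef j r v X · v`
# (`NoHeavyLowerTail` cell, stmt-CriticalPhenomena-4575; prover `prim-hp-2`, gen 19 — brick L5 (= S2) of the semantic layer of THEOREM B,
# memo `run/shared/lean/prim/prim-hp-2/MEMO-gen17-lean-certificates.md` §4')

Support file (`--supports stmt-CriticalPhenomena-4575`; imports the COMPUTATIONAL `…SideGlue` / `…TargetAlgebra`).  No definitions, no named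
facts, no sorries.
Setting: frame `V : Verts n` (stars `x,y,z`, relays `a₁,a₂,a₃`), pendant weights `u` (`K = C + x + y + z + pairs`), `b ∉ {x,y,z}`, the contraction
`K/{x,y}` realised as `u' = u[s(x,y) ↦ 1]` with observer `x` (as in `KNGoodGC3Adj.gc_threeRelays_row`), witness relay `relay j`, and `relay r`
the loneliest relay of the residual graph `C + z = restrW {x,y}ᶜ u'` of the pocket `{x,y}`; `a₁` the loneliest relay of the core.
* `Verts.real_update_eq_bexpR` — every `u'`-probability is `bexpR 11` of the deterministic-side probabilities (`force u e 12 (cplus c)`).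
* `Verts.X_restrW_xy`, `Verts.worldQ_restrW_xy` — the world law of the lone star `z` of `C + z` is `bexp 11 (gz π) X`;
  `Verts.real_restrW_xy_relay` — `μ_{C+z}(relay r ↔ b) = Σ_π bexp 11 (gz π) X · rel π (relay r)`.
* **`Verts.target_expansion`** —
  `μ_{u'}(x b) − μ_{u'}(relay j b) + Σ_{W ∩ A = ∅} μ_{u'}(C(x) = W) · min_a μ_{u'}(a ↔ b off W) = Σ_{v=0..4} bexp 11 (phiHat j r · v) X · v`,
  `(v₀,…,v₄) = (α,β,γ,δ,ε) = (rel 0 a₂ − rel 0 a₁, rel 0 a₃ − rel 0 a₂, rel 5 a₁ − rel 5 a₂, rel 6 a₂ − rel 6 a₁, rel 3 a₁ − rel 3 a₃)`;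
  `bexp 11 (phiHat j r · v) X` is `KNGoodGMgc.phiCoef j r v X` of `…KNGoodGMgcCertificate` — the left factor of `certificate_j*`.
-/

noncomputable section

namespace Summit.CriticalPhenomena.PercolationContinuityZ3.Theorems

namespace KNGoodGMgc

open MeasureTheory Set Literature.Probability.LatticeModels Literature.Probability.Percolation KNGoodAux
open scoped Classical BigOperators

variable {n : ℕ}

/-- `bexpR` respects subtraction. [folklore] -/
theorem bexpR_sub : ∀ (m : ℕ) (F G : Cfg → ℝ) (x : ℕ → ℝ), bexpR m (fun c => F c - G c) x = bexpR m F x - bexpR m G x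
  | 0, F, G, x => by simp [bexpR_zero]
  | m + 1, F, G, x => by rw [bexpR_succ, bexpR_succ, bexpR_succ, bexpR_sub m, bexpR_sub m]; ring

/-- A configuration vanishing from bit `12` on is its own truncation. [this work] -/
theorem trunc_eq_self (c : Cfg) (hc : ∀ k, 12 ≤ k → c k = false) : trunc c = c := by
  funext k
  by_cases hk : k < 12
  · exact trunc_apply c k hk
  · rw [hc k (Nat.le_of_not_lt hk)]
    unfold trunc mk12
    split <;> first | rfl | omega

/-- `P0` is the indicator of the pocket `{x,y}`: no relay picked and both `z`-pairs closed. [this work] -/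
theorem P0_eq (c : Cfg) : (P0 c : ℝ) = if pick c = 0 ∧ (c 9 || c 10) = false then 1 else 0 := by
  unfold P0 pick
  cases c 0 <;> cases c 1 <;> cases c 2 <;> cases c 3 <;> cases c 4 <;> cases c 5 <;> cases c 9 <;> cases c 10 <;> simp

/-- `P0` reads only the bits `0–5, 9, 10`. [this work] -/
theorem P0_dep : DepOn (fun i => i < 6 ∨ i = 9 ∨ i = 10) P0 := by
  intro c c' h
  simp only [P0, h 0 (by norm_num), h 1 (by norm_num), h 2 (by norm_num), h 3 (by norm_num), h 4 (by norm_num), h 5 (by norm_num),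
    h 9 (by norm_num), h 10 (by norm_num)]

/-- `gz π` reads only the `z`-hair bits `6,7,8`. [this work] -/
theorem gz_dep (π : ℕ) : DepOn (fun i => i = 6 ∨ i = 7 ∨ i = 8) (gz π) := by
  intro c c' h
  simp only [gz, zonly, h 6 (by norm_num), h 7 (by norm_num), h 8 (by norm_num)]

/-- Side edges from index `12` on are the junk loop at `x`. [this work] -/
theorem sideAt_of_ge (k : ℕ) (hk : 12 ≤ k) : sideAt k = (0, 0) := by
  unfold sideAt sideAbs
  exact List.getD_eq_default _ _ (by simpa using hk)

namespace Verts

variable (V : Verts n) {u : Sym2 (Fin n) → unitInterval} (hP : V.Pendant u) (b : Fin n)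
  (hb : b ∉ ({V.x, V.y, V.z} : Finset (Fin n)))
include hP hb

omit hP hb in
/-- **Decomposition of `u' = u[xy ↦ 1]` over the deterministic sides.** [this work] -/
theorem real_update_eq_bexpR (E : Set (BondConfig (Fin n))) :
    (prodBernoulli (Function.update u (V.e 11) 1)).real E =
      bexpR 11 (fun c => (prodBernoulli (force u V.e 12 (cplus c))).real E) (V.X u) := by
  have hinj : ∀ i j, i < 11 → j < 11 → i ≠ j → V.e i ≠ V.e j := fun i j hi hj hij => V.e_inj i j (by omega) (by omega) hij
  rw [real_eq_bexpR_force E V.e 11 hinj (Function.update u (V.e 11) 1)]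
  rw [bexpR_congr 11 (fun c => by rw [V.force_update_eq u c])]
  refine bexpR_congr_weights 11 _ _ _ fun k hk => ?_
  have hne : V.e k ≠ V.e 11 := V.e_inj k 11 (by omega) (by norm_num) (Nat.ne_of_lt hk)
  unfold Verts.X
  rw [Function.update_of_ne hne]

omit hP hb in
/-- The side weights of `C + z = restrW {x,y}ᶜ u'`: only the hairs of `z` survive. [this work] -/
theorem X_restrW_xy (k : ℕ) :
    V.X (restrW ((↑({V.x, V.y} : Finset (Fin n)) : Set (Fin n))ᶜ) (Function.update u (V.e 11) 1)) k =
      if (k = 6 ∨ k = 7 ∨ k = 8) then V.X u k else 0 := by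
  unfold Verts.X restrW
  by_cases hk : k = 6 ∨ k = 7 ∨ k = 8
  · rw [if_pos hk]
    have hmem : V.e k ∈ wireSet ((↑({V.x, V.y} : Finset (Fin n)) : Set (Fin n))ᶜ) := by
      rcases hk with rfl | rfl | rfl
      · rw [V.e_6]; exact mk_mem_wireSet_iff.2 ⟨by simp [V.hxz.symm, V.hyz.symm], by simp [V.hxa₁.symm, V.hya₁.symm], V.hza₁⟩
      · rw [V.e_7]; exact mk_mem_wireSet_iff.2 ⟨by simp [V.hxz.symm, V.hyz.symm], by simp [V.hxa₂.symm, V.hya₂.symm], V.hza₂⟩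
      · rw [V.e_8]; exact mk_mem_wireSet_iff.2 ⟨by simp [V.hxz.symm, V.hyz.symm], by simp [V.hxa₃.symm, V.hya₃.symm], V.hza₃⟩
    have hne : V.e k ≠ V.e 11 := by
      rcases hk with rfl | rfl | rfl <;> exact V.e_inj _ 11 (by norm_num) (by norm_num) (by norm_num)
    rw [if_pos hmem, Function.update_of_ne hne]
  · rw [if_neg hk, if_neg]
    · rfl
    · intro hmem
      have h1 := hmem.1
      by_cases hk12 : k < 12
      · have hx : V.x ∉ V.e k := fun h => h1 V.x h (by simp)
        have hy : V.y ∉ V.e k := fun h => h1 V.y h (by simp)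
        interval_cases k <;> simp_all
      · have : V.e k = s(V.x, V.x) := by
          unfold Verts.e; rw [sideAt_of_ge k (Nat.le_of_not_lt hk12)]; rfl
        exact h1 V.x (by rw [this]; exact Sym2.mem_mk_left _ _) (by simp)

omit hP hb in
/-- **The world law of the lone star `z`** of `C + z`: `bexp 12 (qHat [π]) (X of C+z) = bexp 11 (gz π) X`. [this work] -/
theorem worldQ_restrW_xy (π : ℕ) :
    bexp 12 (qHat [π]) (V.X (restrW ((↑({V.x, V.y} : Finset (Fin n)) : Set (Fin n))ᶜ) (Function.update u (V.e 11) 1))) =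
      bexp 11 (gz π) (V.X u) := by
  set Xz : ℕ → ℝ := fun k => if (k = 6 ∨ k = 7 ∨ k = 8) then V.X u k else 0 with hXz
  have hX : V.X (restrW ((↑({V.x, V.y} : Finset (Fin n)) : Set (Fin n))ᶜ) (Function.update u (V.e 11) 1)) = Xz :=
    funext fun k => V.X_restrW_xy k
  rw [hX]
  have z0 : ∀ k, ¬(k = 6 ∨ k = 7 ∨ k = 8) → Xz k = 0 := fun k hk => by simp [hXz, hk]
  rw [bexp_update_false_of_zero 0 Xz (z0 0 (by norm_num)) 12 _ (by norm_num),
    bexp_update_false_of_zero 1 Xz (z0 1 (by norm_num)) 12 _ (by norm_num),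
    bexp_update_false_of_zero 2 Xz (z0 2 (by norm_num)) 12 _ (by norm_num),
    bexp_update_false_of_zero 3 Xz (z0 3 (by norm_num)) 12 _ (by norm_num),
    bexp_update_false_of_zero 4 Xz (z0 4 (by norm_num)) 12 _ (by norm_num),
    bexp_update_false_of_zero 5 Xz (z0 5 (by norm_num)) 12 _ (by norm_num),
    bexp_update_false_of_zero 9 Xz (z0 9 (by norm_num)) 12 _ (by norm_num),
    bexp_update_false_of_zero 10 Xz (z0 10 (by norm_num)) 12 _ (by norm_num),
    bexp_update_false_of_zero 11 Xz (z0 11 (by norm_num)) 12 _ (by norm_num)]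
  rw [bexp_congr 12 (g := gz π) (fun c => by
    unfold gz qHat
    rw [sideWorld_congr _ (zonly c) (fun k hk => by
      interval_cases k <;> simp [zonly, mk12])])]
  rw [bexp_congr_weights_of_dep _ Xz (V.X u) (fun k hk => by simp [hXz, hk]) 12 (gz π) (gz_dep π)]
  exact bexp_succ_of_dep 11 (gz π) ((gz_dep π).mono fun i hi => by rcases hi with rfl | rfl | rfl <;> norm_num) (V.X u)

omit hP hb in
/-- The glued cores of `C + z` and of `K` agree off the diagonal. [this work] -/
theorem glued_restrW_xy_offDiag (π : ℕ) (f : Sym2 (Fin n)) (hf : ¬f.IsDiag) :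
    V.glued (restrW ((↑({V.x, V.y} : Finset (Fin n)) : Set (Fin n))ᶜ) (Function.update u (V.e 11) 1)) π f = V.glued u π f := by
  unfold Verts.glued Verts.core restrW
  by_cases hx : V.x ∈ f
  · simp [hx]
  by_cases hy : V.y ∈ f
  · simp [hx, hy]
  by_cases hz : V.z ∈ f
  · simp [hx, hy, hz]
  have hmem : f ∈ wireSet ((↑({V.x, V.y} : Finset (Fin n)) : Set (Fin n))ᶜ) := by
    refine ⟨fun v hv hv' => ?_, hf⟩
    simp only [Finset.coe_insert, Finset.coe_singleton, mem_insert_iff, mem_singleton_iff] at hv'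
    rcases hv' with rfl | rfl
    · exact hx hv
    · exact hy hv
  have hne : f ≠ V.e 11 := by intro h; rw [h, V.e_11] at hx; exact hx (Sym2.mem_mk_left _ _)
  simp only [hx, hy, hz, if_false]
  rw [if_pos hmem, Function.update_of_ne hne]

/-- **The loneliest relay of `C + z`, expanded over the worlds of the lone star `z`.** [this work] -/
theorem real_restrW_xy_relay (i : ℕ) :
    (prodBernoulli (restrW ((↑({V.x, V.y} : Finset (Fin n)) : Set (Fin n))ᶜ) (Function.update u (V.e 11) 1))).real
        (openConn (V.relay i) b) =
      bexp 11 (gz 0) (V.X u) * V.R u b 0 i + bexp 11 (gz 3) (V.X u) * V.R u b 3 i + bexp 11 (gz 5) (V.X u) * V.R u b 5 i +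
        bexp 11 (gz 6) (V.X u) * V.R u b 6 i + bexp 11 (gz 7) (V.X u) * V.R u b 7 i := by
  rw [V.real_openConn_worldMix (V.restrW_xy_pendant hP) (V.relay i) b (V.relay_not_mem i) hb]
  simp only [V.worldQ_restrW_xy]
  have hg : ∀ π, (prodBernoulli (V.glued (restrW ((↑({V.x, V.y} : Finset (Fin n)) : Set (Fin n))ᶜ)
      (Function.update u (V.e 11) 1)) π)).real (openConn (V.relay i) b) = V.R u b π i :=
    fun π => real_openConn_congr_offDiag _ _ (fun f hf => V.glued_restrW_xy_offDiag π f hf) _ _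
  rw [hg, hg, hg, hg, hg]


/-- **Target expansion (THEOREM B, semantic brick S2).**  With `u' = u[xy ↦ 1]`, witness `relay j`, `relay r` loneliest in `C + z`
and `a₁` loneliest in the core, the goodness functional of the observer `x` of `u'` is `Σ_v phiCoef j r v X · v` with
`v = (α,β,γ,δ,ε)` the five core scalars. [this work] -/
theorem target_expansion (j r : ℕ) (hj : j = 1 ∨ j = 2 ∨ j = 3) (hr : r = 1 ∨ r = 2 ∨ r = 3)
    (hA : ({V.a₁, V.a₂, V.a₃} : Finset (Fin n)).Nonempty)
    (hrmin : ∀ a ∈ ({V.a₁, V.a₂, V.a₃} : Finset (Fin n)),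
      (prodBernoulli (restrW ((↑({V.x, V.y} : Finset (Fin n)) : Set (Fin n))ᶜ) (Function.update u (V.e 11) 1))).real
          (openConn (V.relay r) b) ≤
        (prodBernoulli (restrW ((↑({V.x, V.y} : Finset (Fin n)) : Set (Fin n))ᶜ) (Function.update u (V.e 11) 1))).real (openConn a b))
    (hs1 : ∀ a ∈ ({V.a₁, V.a₂, V.a₃} : Finset (Fin n)),
      (prodBernoulli (V.core u)).real (openConn V.a₁ b) ≤ (prodBernoulli (V.core u)).real (openConn a b)) :
    (prodBernoulli (Function.update u (V.e 11) 1)).real (openConn V.x b) -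
        (prodBernoulli (Function.update u (V.e 11) 1)).real (openConn (V.relay j) b) +
        ∑ W ∈ nullSets ({V.a₁, V.a₂, V.a₃} : Finset (Fin n)),
          (prodBernoulli (Function.update u (V.e 11) 1)).real (clusterIs V.x W) *
            ({V.a₁, V.a₂, V.a₃} : Finset (Fin n)).inf' hA
              (fun a => (prodBernoulli (Function.update u (V.e 11) 1)).real (openConnIn ((↑W : Set (Fin n))ᶜ) a b)) =
      bexp 11 (fun c => phiHat j r c 0) (V.X u) * (V.R u b 0 2 - V.R u b 0 1) +
      bexp 11 (fun c => phiHat j r c 1) (V.X u) * (V.R u b 0 3 - V.R u b 0 2) +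
      bexp 11 (fun c => phiHat j r c 2) (V.X u) * (V.R u b 5 1 - V.R u b 5 2) +
      bexp 11 (fun c => phiHat j r c 3) (V.X u) * (V.R u b 6 2 - V.R u b 6 1) +
      bexp 11 (fun c => phiHat j r c 4) (V.X u) * (V.R u b 3 1 - V.R u b 3 3) := by
  haveI : ∀ w : Sym2 (Fin n) → unitInterval, IsProbabilityMeasure (prodBernoulli w) := fun w => inferInstance
  set u' := Function.update u (V.e 11) 1 with hu'
  set A : Finset (Fin n) := {V.a₁, V.a₂, V.a₃} with hAdef
  set uz := restrW ((↑({V.x, V.y} : Finset (Fin n)) : Set (Fin n))ᶜ) u' with huz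
  set Mxy := (prodBernoulli uz).real (openConn (V.relay r) b) with hMxy
  set M : Finset (Fin n) → ℝ := fun W => A.inf' hA (fun a => (prodBernoulli u').real (openConnIn ((↑W : Set (Fin n))ᶜ) a b))
    with hM
  set S : Cfg → ℝ := fun c => (gz 0 c : ℝ) * V.R u b 0 r + (gz 3 c : ℝ) * V.R u b 3 r + (gz 5 c : ℝ) * V.R u b 5 r +
    (gz 6 c : ℝ) * V.R u b 6 r + (gz 7 c : ℝ) * V.R u b 7 r with hS
  set T : Cfg → ℝ := fun c => (if pick c ≠ 0 then V.R u b (sideWorld (cplus c)) (pick c) else 0) - V.R u b (sideWorld (cplus c)) j +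
    (if pick c = 0 ∧ (c 9 || c 10) = true then V.R u b 0 1 else 0) with hT
  have ha₁ : V.a₁ ∈ A := by simp [hAdef]
  have hAside : ∀ a ∈ A, a ∉ ({V.x, V.y, V.z} : Finset (Fin n)) := by
    intro a ha; simp only [hAdef, Finset.mem_insert, Finset.mem_singleton] at ha
    rcases ha with rfl | rfl | rfl
    · exact V.a₁_not_mem
    · exact V.a₂_not_mem
    · exact V.a₃_not_mem
  -- the residual graph of the pocket `{x,y,z}`: the core, loneliest relay `a₁`
  have hMxyz : M {V.x, V.y, V.z} = V.R u b 0 1 := by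
    have key : ∀ a ∈ A, (prodBernoulli u').real (openConnIn ((↑({V.x, V.y, V.z} : Finset (Fin n)) : Set (Fin n))ᶜ) a b) =
        (prodBernoulli (V.core u)).real (openConn a b) := fun a ha => V.real_openConnIn_xyz a b (hAside a ha) hb
    have e1 : V.R u b 0 1 = (prodBernoulli (V.core u)).real (openConn V.a₁ b) := V.rel_zero u b V.a₁
    rw [e1]
    refine le_antisymm ?_ ?_
    · calc M {V.x, V.y, V.z} ≤ (prodBernoulli u').real (openConnIn ((↑({V.x, V.y, V.z} : Finset (Fin n)) : Set (Fin n))ᶜ) V.a₁ b) :=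
            Finset.inf'_le _ ha₁
        _ = _ := key V.a₁ ha₁
    · refine Finset.le_inf' hA _ fun a ha => ?_
      rw [key a ha]; exact hs1 a ha
  -- the residual graph of the pocket `{x,y}`: `C + z`, loneliest relay `relay r`
  have hMxy' : M {V.x, V.y} = Mxy := by
    have key : ∀ a ∈ A, (prodBernoulli u').real (openConnIn ((↑({V.x, V.y} : Finset (Fin n)) : Set (Fin n))ᶜ) a b) =
        (prodBernoulli uz).real (openConn a b) := fun a ha =>
      real_openConnIn_eq_restrW u' _ a b (fun h => by
        have ha' := hAside a ha
        simp only [Finset.coe_insert, Finset.coe_singleton, mem_insert_iff, mem_singleton_iff] at h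
        rcases h with rfl | rfl <;> simp at ha')
    refine le_antisymm ?_ ?_
    · calc M {V.x, V.y} ≤ (prodBernoulli u').real (openConnIn ((↑({V.x, V.y} : Finset (Fin n)) : Set (Fin n))ᶜ) (V.relay r) b) :=
            Finset.inf'_le _ (V.relay_mem r)
        _ = Mxy := key _ (V.relay_mem r)
    · refine Finset.le_inf' hA _ fun a ha => ?_
      rw [key a ha]; exact hrmin a ha
  -- Step 1: the left-hand side over the deterministic sides
  have hL : (prodBernoulli u').real (openConn V.x b) - (prodBernoulli u').real (openConn (V.relay j) b) +
      ∑ W ∈ nullSets A, (prodBernoulli u').real (clusterIs V.x W) * M W =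
      bexpR 11 (fun c => T c + (P0 c : ℝ) * Mxy) (V.X u) := by
    rw [V.real_update_eq_bexpR (openConn V.x b), V.real_update_eq_bexpR (openConn (V.relay j) b)]
    have hsum : ∑ W ∈ nullSets A, (prodBernoulli u').real (clusterIs V.x W) * M W =
        bexpR 11 (fun c => ∑ W ∈ nullSets A, (prodBernoulli (force u V.e 12 (cplus c))).real (clusterIs V.x W) * M W) (V.X u) := by
      rw [bexpR_finset_sum]
      refine Finset.sum_congr rfl fun W _ => ?_
      rw [V.real_update_eq_bexpR (clusterIs V.x W), ← bexpR_mul_const]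
    rw [hsum, ← bexpR_sub, ← bexpR_add]
    refine bexpR_eq_of_agree 11 _ _ (fun c _ => ?_) (V.X u)
    have hj' : (prodBernoulli (force u V.e 12 (cplus c))).real (openConn (V.relay j) b) = V.R u b (sideWorld (cplus c)) j :=
      V.real_relay_cell hP c b hb (V.relay j) (V.relay_not_mem j)
    simp only [hT]
    rw [hj', P0_eq]
    by_cases hp : pick c = 0
    · -- no relay picked: `x ↮ b`, and exactly one pocket
      rw [V.real_x_eq_zero hP c hp b hb]
      have hU1 := V.real_clusterIs_U hP c hp
      rw [Finset.sum_eq_single_of_mem (V.U c) (V.U_mem_nullSets c) (fun W _ hW =>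
        by rw [real_clusterIs_eq_zero_of_ne _ (V.U c) W V.x hU1 hW, zero_mul]), hU1, one_mul]
      by_cases h910 : (c 9 || c 10) = true
      · have hU : V.U c = {V.x, V.y, V.z} := by simp [Verts.U, h910]
        rw [hU, hMxyz]; simp [hp, h910]
      · have hU : V.U c = {V.x, V.y} := by simp [Verts.U, h910]
        rw [hU, hMxy']; simp [hp, h910]
    · -- a relay is picked: `x` behaves like it, no pocket survives
      rw [real_openConn_eq_of_joined _ V.x (V.relay (pick c)) b (V.real_x_joined c hp),
        V.real_relay_cell hP c b hb (V.relay (pick c)) (V.relay_not_mem (pick c)),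
        Finset.sum_eq_zero (fun W hW => by rw [V.real_clusterIs_null_of_pick c hp W hW, zero_mul])]
      simp [hp, Verts.R]
  -- Step 2: the right-hand side over the deterministic sides
  have hR : bexp 11 (fun c => phiHat j r c 0) (V.X u) * (V.R u b 0 2 - V.R u b 0 1) +
      bexp 11 (fun c => phiHat j r c 1) (V.X u) * (V.R u b 0 3 - V.R u b 0 2) +
      bexp 11 (fun c => phiHat j r c 2) (V.X u) * (V.R u b 5 1 - V.R u b 5 2) +
      bexp 11 (fun c => phiHat j r c 3) (V.X u) * (V.R u b 6 2 - V.R u b 6 1) +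
      bexp 11 (fun c => phiHat j r c 4) (V.X u) * (V.R u b 3 1 - V.R u b 3 3) =
      bexpR 11 (fun c => T c + (P0 c : ℝ) * S c) (V.X u) := by
    rw [← bexpR_five]
    refine bexpR_eq_of_agree 11 _ _ (fun c hc => ?_) (V.X u)
    have htr : trunc c = c := trunc_eq_self c (fun k hk => hc k (by omega))
    have hall := semCheck_all (c 0) (c 1) (c 2) (c 3) (c 4) (c 5) (c 6) (c 7) (c 8) (c 9) (c 10) (c 11)
    rw [show mk12 (c 0) (c 1) (c 2) (c 3) (c 4) (c 5) (c 6) (c 7) (c 8) (c 9) (c 10) (c 11) = trunc c from rfl, htr] at hall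
    have hjm : j ∈ [1, 2, 3] := by rcases hj with rfl | rfl | rfl <;> simp
    have hrm : r ∈ [1, 2, 3] := by rcases hr with rfl | rfl | rfl <;> simp
    have hchk : feq (nf (semF j r c)) (nf (vexp (phiHat j r c))) = true :=
      List.all_eq_true.1 (List.all_eq_true.1 hall j hjm) r hrm
    calc ((phiHat j r c 0 : ℤ) : ℝ) * (V.R u b 0 2 - V.R u b 0 1) + ((phiHat j r c 1 : ℤ) : ℝ) * (V.R u b 0 3 - V.R u b 0 2) +
          ((phiHat j r c 2 : ℤ) : ℝ) * (V.R u b 5 1 - V.R u b 5 2) + ((phiHat j r c 3 : ℤ) : ℝ) * (V.R u b 6 2 - V.R u b 6 1) +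
          ((phiHat j r c 4 : ℤ) : ℝ) * (V.R u b 3 1 - V.R u b 3 3)
        = V.evalF u b (vexp (phiHat j r c)) := (V.evalF_vexp u b _).symm
      _ = V.evalF u b (nf (vexp (phiHat j r c))) := (V.evalF_nf u b _).symm
      _ = V.evalF u b (nf (semF j r c)) := (V.evalF_congr_of_feq u b _ _ hchk).symm
      _ = V.evalF u b (semF j r c) := V.evalF_nf u b _
      _ = T c + (P0 c : ℝ) * S c := by rw [V.evalF_semF u b j r hj hr c]
  -- Step 3: the pocket `{x,y}` redistributed over the hair patterns of `z`
  have hMz : Mxy = bexp 11 (gz 0) (V.X u) * V.R u b 0 r + bexp 11 (gz 3) (V.X u) * V.R u b 3 r +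
      bexp 11 (gz 5) (V.X u) * V.R u b 5 r + bexp 11 (gz 6) (V.X u) * V.R u b 6 r + bexp 11 (gz 7) (V.X u) * V.R u b 7 r :=
    V.real_restrW_xy_relay hP b hb r
  have hdis : ∀ i : ℕ, ¬((i < 6 ∨ i = 9 ∨ i = 10) ∧ (i = 6 ∨ i = 7 ∨ i = 8)) := fun i => by omega
  have hprod : ∀ π, bexp 11 (fun c => P0 c * gz π c) (V.X u) = bexp 11 P0 (V.X u) * bexp 11 (gz π) (V.X u) :=
    fun π => bexp_mul_disjoint _ _ hdis 11 P0 (gz π) P0_dep (gz_dep π) (V.X u)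
  have hE : bexpR 11 (fun c => T c + (P0 c : ℝ) * Mxy) (V.X u) = bexpR 11 (fun c => T c + (P0 c : ℝ) * S c) (V.X u) := by
    have l1 : bexpR 11 (fun c => T c + (P0 c : ℝ) * Mxy) (V.X u) = bexpR 11 T (V.X u) + bexp 11 P0 (V.X u) * Mxy := by
      rw [bexpR_add]; congr 1; rw [bexpR_mul_const, bexpR_intCast]
    have e : (fun c => (P0 c : ℝ) * S c) = fun c =>
        ((P0 c * gz 0 c : ℤ) : ℝ) * V.R u b 0 r + ((P0 c * gz 3 c : ℤ) : ℝ) * V.R u b 3 r + ((P0 c * gz 5 c : ℤ) : ℝ) * V.R u b 5 r +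
          ((P0 c * gz 6 c : ℤ) : ℝ) * V.R u b 6 r + ((P0 c * gz 7 c : ℤ) : ℝ) * V.R u b 7 r := by
      funext c; simp only [hS]; push_cast; ring
    have l2 : bexpR 11 (fun c => T c + (P0 c : ℝ) * S c) (V.X u) = bexpR 11 T (V.X u) +
        (bexp 11 P0 (V.X u) * bexp 11 (gz 0) (V.X u) * V.R u b 0 r + bexp 11 P0 (V.X u) * bexp 11 (gz 3) (V.X u) * V.R u b 3 r +
          bexp 11 P0 (V.X u) * bexp 11 (gz 5) (V.X u) * V.R u b 5 r + bexp 11 P0 (V.X u) * bexp 11 (gz 6) (V.X u) * V.R u b 6 r +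
          bexp 11 P0 (V.X u) * bexp 11 (gz 7) (V.X u) * V.R u b 7 r) := by
      rw [bexpR_add]; congr 1; rw [e, bexpR_five, hprod, hprod, hprod, hprod, hprod]
    rw [l1, l2, hMz]
    ring
  rw [hL, hE, ← hR]

end Verts

end KNGoodGMgc

end Summit.CriticalPhenomena.PercolationContinuityZ3.Theorems

end
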